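import Summits.Ventures.HodgeRepro2.T5ConvolutionAdjoint
import Mathlib.Topology.UrysohnsLemma
import Mathlib.MeasureTheory.Measure.Haar.Basic

/-!
# T5DiracApproximation — Dirac bumps, `η(φ) v → v`, and the non-degeneracy of `η(C_c(G))`

Cell pub-hodge-repro2, seat p5, Tier 5 (route/T5-N4-p5.md, N4.3 v13 (B1)–(B2)).  [DE] Lemma
9.2.7 (quoted at l. 157) needs, besides compactness, that «for every non-zero `v ∈ V_η` the space
`η(A)v` is non-zero».  For `A ⊇ {symmetric bumps}` this is the Dirac approximation
`η(φ_n) v → v` of [DE] §9.2 — elementary, and kernel-checked here: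

* `norm_etaOp_sub_le` — the **Dirac estimate**: for a real `φ ≥ 0` with `∫ φ = 1` and
  `‖ρ(g) v − v‖ ≤ ε` wherever `φ(g) ≠ 0`, `‖η(φ) v − v‖ ≤ ε` (`η(φ) v − v = ∫ φ(g) (ρ(g) v − v)`);
* `exists_symmetric_bump` — **symmetric Dirac bumps**: for every open `U ∋ 1` of a locally compact
  group with an open-positive measure finite on compacts there is a continuous compactly supported
  `φ ≥ 0` with `φ(g⁻¹) = φ(g)`, `φ = 0` off `U`, `∫ φ = 1` (Mathlib's Urysohn lemma
  `exists_continuous_one_zero_of_isCompact`, symmetrised `ψ(g) + ψ(g⁻¹)`, normalised by the positive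
  integral `Continuous.integral_pos_of_hasCompactSupport_nonneg_nonzero`);
* `exists_bump_norm_etaOp_sub_le` (Dirac approximation for a strongly continuous `ρ`) and
  `exists_bump_etaOp_ne_zero`: **for `v ≠ 0` some symmetric bump has `η(φ) v ≠ 0`** — row 49's
  joint non-degeneracy `hnd` for the family `{η(f) ∣ f ∈ C_c(G), f* = f}`;
* `exists_pairwise_isOrtho_irreducibleOn_of_isCompactOperator_etaOpL` — **[DE] Theorem 9.2.2
  modulo compactness**: for a strongly continuous unitary `ρ` of a locally compact group with a
  Haar-type measure, if every `η(f)`, `f ∈ C_c(G)`, `f* = f`, is a compact operator, then `E` is the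
  closed orthogonal sum of irreducible closed stable subspaces (rows 49–51 + this file).

What stays prose [C] is exactly the compactness of `η(f)` on `L²(Γ\G)` for `Γ` cocompact ([DE]
Lemmas 9.2.3–9.2.4: `η(f)` is an integral operator with a continuous kernel on the compact
`Γ\G × Γ\G`, hence Hilbert–Schmidt).  Mathlib only besides row 51's import chain.  Axioms:
propext, Classical.choice, Quot.sound.  README §8(d): uses an L-value-free non-vanishing device: NO.
-/

namespace Summit.Ventures.HodgeRepro2.T5DiracApproximation

open MeasureTheory Filter Topology
open Summit.Ventures.HodgeRepro2.T5ConvolutionNatural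
open Summit.Ventures.HodgeRepro2.T5ConvolutionAdjoint
open Summit.Ventures.HodgeRepro2.T5CompactDiscreteDecomposition (IrreducibleOn
  exists_pairwise_isOrtho_irreducibleOn)

variable {E : Type*} [NormedAddCommGroup E] [InnerProductSpace ℂ E] [CompleteSpace E]
variable {G : Type*} [Group G] [MeasurableSpace G]

/-! ### The Dirac estimate -/

/-- `η(f) v − v = ∫ f(g) • (ρ(g) v − v)` when `∫ f = 1`. -/
theorem etaOp_sub_eq (μ : Measure G) (ρ : G →* (E →L[ℂ] E)) {f : G → ℂ} (hf : Integrable f μ)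
    (hf1 : ∫ g, f g ∂μ = 1) (v : E) (hint : Integrable (fun g => f g • ρ g v) μ) :
    etaOp μ ρ f v - v = ∫ g, f g • (ρ g v - v) ∂μ := by
  have h2 : Integrable (fun g => f g • v) μ := hf.smul_const v
  have h3 : ∫ g, f g • v ∂μ = v := by rw [integral_smul_const, hf1, one_smul]
  calc etaOp μ ρ f v - v = (∫ g, f g • ρ g v ∂μ) - ∫ g, f g • v ∂μ := by rw [h3]; rfl
    _ = ∫ g, f g • ρ g v - f g • v ∂μ := (integral_sub hint h2).symm
    _ = ∫ g, f g • (ρ g v - v) ∂μ := by simp only [smul_sub]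

/-- **The Dirac estimate.** For a real `φ ≥ 0` with `∫ φ = 1` and `‖ρ(g) v − v‖ ≤ ε` wherever
`φ(g) ≠ 0`: `‖η(φ) v − v‖ ≤ ε`. -/
theorem norm_etaOp_sub_le (μ : Measure G) (ρ : G →* (E →L[ℂ] E)) {φ : G → ℝ}
    (hφ : Integrable φ μ) (hφ0 : ∀ g, 0 ≤ φ g) (hφ1 : ∫ g, φ g ∂μ = 1) (v : E) {ε : ℝ}
    (hε : ∀ g, φ g ≠ 0 → ‖ρ g v - v‖ ≤ ε)
    (hint : Integrable (fun g => (φ g : ℂ) • ρ g v) μ) :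
    ‖etaOp μ ρ (fun g => (φ g : ℂ)) v - v‖ ≤ ε := by
  have hfc : Integrable (fun g => (φ g : ℂ)) μ := hφ.ofReal
  have hf1 : ∫ g, (φ g : ℂ) ∂μ = 1 := by rw [integral_complex_ofReal, hφ1, Complex.ofReal_one]
  rw [etaOp_sub_eq μ ρ hfc hf1 v hint]
  have hpt : ∀ g, ‖(φ g : ℂ) • (ρ g v - v)‖ ≤ φ g * ε := fun g => by
    rw [norm_smul, Complex.norm_real, Real.norm_of_nonneg (hφ0 g)]
    by_cases h : φ g = 0
    · simp [h]
    · exact mul_le_mul_of_nonneg_left (hε g h) (hφ0 g)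
  calc ‖∫ g, (φ g : ℂ) • (ρ g v - v) ∂μ‖ ≤ ∫ g, ‖(φ g : ℂ) • (ρ g v - v)‖ ∂μ :=
        norm_integral_le_integral_norm _
    _ ≤ ∫ g, φ g * ε ∂μ :=
        integral_mono_of_nonneg (Eventually.of_forall fun g => norm_nonneg _) (hφ.mul_const ε)
          (Eventually.of_forall hpt)
    _ = ε := by rw [integral_mul_const, hφ1, one_mul]

/-! ### Strong continuity at `1` -/

omit [CompleteSpace E] [MeasurableSpace G] in
/-- Strong continuity at `1`: `‖ρ(g) v − v‖ < ε` on an open neighbourhood of `1`. -/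
theorem exists_isOpen_norm_sub_lt [TopologicalSpace G] (ρ : G →* (E →L[ℂ] E))
    (hρc : ∀ v : E, Continuous fun g => ρ g v) (v : E) {ε : ℝ} (hε : 0 < ε) :
    ∃ U : Set G, IsOpen U ∧ (1 : G) ∈ U ∧ ∀ g ∈ U, ‖ρ g v - v‖ < ε := by
  have h1 : Tendsto (fun g => ρ g v) (𝓝 (1 : G)) (𝓝 v) := by
    have h := (hρc v).continuousAt (x := (1 : G))
    have h1v : ρ 1 v = v := by rw [map_one]; rfl
    rwa [ContinuousAt, h1v] at h
  have h2 : ∀ᶠ g in 𝓝 (1 : G), ‖ρ g v - v‖ < ε := by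
    filter_upwards [Metric.tendsto_nhds.1 h1 ε hε] with g hg
    rwa [dist_eq_norm] at hg
  obtain ⟨U, hUsub, hUo, h1U⟩ := mem_nhds_iff.1 h2
  exact ⟨U, hUo, h1U, fun g hg => hUsub hg⟩

/-! ### Symmetric Dirac bumps -/

/-- **Symmetric Dirac bumps.** For every open `U ∋ 1` of a locally compact group carrying an
open-positive measure finite on compacts (a Haar measure) there is a continuous compactly
supported `φ ≥ 0` with `φ(g⁻¹) = φ(g)`, vanishing off `U`, and `∫ φ = 1`. -/
theorem exists_symmetric_bump [TopologicalSpace G] [IsTopologicalGroup G] [LocallyCompactSpace G]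
    [OpensMeasurableSpace G] (μ : Measure G) [μ.IsOpenPosMeasure] [IsFiniteMeasureOnCompacts μ]
    {U : Set G} (hUo : IsOpen U) (h1U : (1 : G) ∈ U) :
    ∃ φ : G → ℝ, Continuous φ ∧ HasCompactSupport φ ∧ (∀ g, 0 ≤ φ g) ∧ (∀ g, φ g⁻¹ = φ g) ∧
      (∀ g, φ g ≠ 0 → g ∈ U) ∧ ∫ g, φ g ∂μ = 1 := by
  -- a symmetric open neighbourhood `V = U ∩ U⁻¹` of `1`
  have hVo : IsOpen (U ∩ U⁻¹) := hUo.inter hUo.inv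
  have h1V : (1 : G) ∈ U ∩ U⁻¹ := ⟨h1U, by rw [Set.mem_inv, inv_one]; exact h1U⟩
  have hVsymm : ∀ g, g ∈ U ∩ U⁻¹ → g⁻¹ ∈ U ∩ U⁻¹ := fun g hg =>
    ⟨Set.mem_inv.1 hg.2, Set.inv_mem_inv.2 hg.1⟩
  -- Urysohn: `ψ = 1` at `1`, `ψ = 0` off `V`, `0 ≤ ψ ≤ 1`, compact support
  obtain ⟨ψ, hψ1, hψ0, hψc, hψ01⟩ := exists_continuous_one_zero_of_isCompact
    (isCompact_singleton : IsCompact ({1} : Set G)) hVo.isClosed_compl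
    (Set.disjoint_singleton_left.2 fun h => h h1V)
  -- symmetrise: `ψ₀ g = ψ g + ψ g⁻¹`
  have hψ₀c : Continuous fun g : G => ψ g + ψ g⁻¹ :=
    ψ.continuous.add (ψ.continuous.comp continuous_inv)
  have hψ₀s : HasCompactSupport fun g : G => ψ g + ψ g⁻¹ :=
    hψc.add (hψc.comp_homeomorph (Homeomorph.inv G))
  have hψ₀0 : ∀ g : G, 0 ≤ ψ g + ψ g⁻¹ := fun g => add_nonneg (hψ01 g).1 (hψ01 g⁻¹).1
  have hψ₀symm : ∀ g : G, ψ g⁻¹ + ψ g⁻¹⁻¹ = ψ g + ψ g⁻¹ := fun g => by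
    rw [inv_inv, add_comm]
  have hψ₀supp : ∀ g : G, ψ g + ψ g⁻¹ ≠ 0 → g ∈ U ∩ U⁻¹ := fun g hg => by
    by_contra hgV
    apply hg
    have h1 : ψ g = 0 := hψ0 hgV
    have h2 : ψ g⁻¹ = 0 := hψ0 fun h => hgV (by simpa using hVsymm _ h)
    rw [h1, h2, add_zero]
  -- the integral is positive (`ψ₀ 1 = 2`)
  have hψ11 : ψ 1 = 1 := hψ1 (Set.mem_singleton 1)
  have hψ₀1 : ψ (1 : G) + ψ (1 : G)⁻¹ ≠ 0 := by rw [inv_one, hψ11]; norm_num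
  have hpos : 0 < ∫ g, (ψ g + ψ g⁻¹) ∂μ :=
    hψ₀c.integral_pos_of_hasCompactSupport_nonneg_nonzero hψ₀s (fun g => hψ₀0 g) hψ₀1
  -- normalise
  refine ⟨fun g => (∫ g, (ψ g + ψ g⁻¹) ∂μ)⁻¹ * (ψ g + ψ g⁻¹), continuous_const.mul hψ₀c,
    hψ₀s.mul_left, fun g => mul_nonneg (inv_pos.2 hpos).le (hψ₀0 g), fun g => ?_,
    fun g hg => ?_, ?_⟩
  · show (∫ g, (ψ g + ψ g⁻¹) ∂μ)⁻¹ * (ψ g⁻¹ + ψ g⁻¹⁻¹) =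
      (∫ g, (ψ g + ψ g⁻¹) ∂μ)⁻¹ * (ψ g + ψ g⁻¹)
    rw [hψ₀symm]
  · refine (hψ₀supp g fun h => hg ?_).1
    show (∫ g, (ψ g + ψ g⁻¹) ∂μ)⁻¹ * (ψ g + ψ g⁻¹) = 0
    rw [h, mul_zero]
  · show ∫ g, (∫ g, (ψ g + ψ g⁻¹) ∂μ)⁻¹ * (ψ g + ψ g⁻¹) ∂μ = 1
    rw [integral_const_mul, inv_mul_cancel₀ hpos.ne']

/-! ### Dirac approximation and non-degeneracy -/

/-- **Dirac approximation.** For a strongly continuous `ρ` of a locally compact group, a vector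
`v` and `ε > 0` there is a symmetric bump `φ` (continuous, compactly supported, `φ ≥ 0`,
`φ(g⁻¹) = φ(g)`, `∫ φ = 1`) with `‖η(φ) v − v‖ ≤ ε`. -/
theorem exists_bump_norm_etaOp_sub_le [TopologicalSpace G] [IsTopologicalGroup G]
    [LocallyCompactSpace G] [OpensMeasurableSpace G] (μ : Measure G) [μ.IsOpenPosMeasure]
    [IsFiniteMeasureOnCompacts μ] (ρ : G →* (E →L[ℂ] E))
    (hρc : ∀ v : E, Continuous fun g => ρ g v) (v : E) {ε : ℝ} (hε : 0 < ε) :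
    ∃ φ : G → ℝ, Continuous φ ∧ HasCompactSupport φ ∧ (∀ g, 0 ≤ φ g) ∧ (∀ g, φ g⁻¹ = φ g) ∧
      ∫ g, φ g ∂μ = 1 ∧ ‖etaOp μ ρ (fun g => (φ g : ℂ)) v - v‖ ≤ ε := by
  obtain ⟨U, hUo, h1U, hU⟩ := exists_isOpen_norm_sub_lt ρ hρc v hε
  obtain ⟨φ, hφc, hφs, hφ0, hφsymm, hφU, hφ1⟩ := exists_symmetric_bump μ hUo h1U
  refine ⟨φ, hφc, hφs, hφ0, hφsymm, hφ1, ?_⟩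
  have hφint : Integrable φ μ := hφc.integrable_of_hasCompactSupport hφs
  have hfc : Continuous fun g => (φ g : ℂ) • ρ g v :=
    (Complex.continuous_ofReal.comp hφc).smul (hρc v)
  have hfs : HasCompactSupport fun g => (φ g : ℂ) • ρ g v :=
    (hφs.comp_left Complex.ofReal_zero).smul_right
  exact norm_etaOp_sub_le μ ρ hφint hφ0 hφ1 v (fun g hg => (hU g (hφU g hg)).le)
    (hfc.integrable_of_hasCompactSupport hfs)

/-- **Non-degeneracy of `η(C_c(G))`** — the hypothesis «`η(A) v ≠ 0` for `v ≠ 0`» of [DE] Lemma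
9.2.7 for `A ⊇ {symmetric bumps}`: for `v ≠ 0` some symmetric bump `φ` has `η(φ) v ≠ 0`
(the Dirac approximation with `ε = ‖v‖ / 2`). -/
theorem exists_bump_etaOp_ne_zero [TopologicalSpace G] [IsTopologicalGroup G]
    [LocallyCompactSpace G] [OpensMeasurableSpace G] (μ : Measure G) [μ.IsOpenPosMeasure]
    [IsFiniteMeasureOnCompacts μ] (ρ : G →* (E →L[ℂ] E))
    (hρc : ∀ v : E, Continuous fun g => ρ g v) {v : E} (hv : v ≠ 0) :
    ∃ φ : G → ℝ, Continuous φ ∧ HasCompactSupport φ ∧ (∀ g, 0 ≤ φ g) ∧ (∀ g, φ g⁻¹ = φ g) ∧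
      etaOp μ ρ (fun g => (φ g : ℂ)) v ≠ 0 := by
  have hv' : 0 < ‖v‖ := norm_pos_iff.2 hv
  obtain ⟨φ, hφc, hφs, hφ0, hφsymm, -, hφv⟩ :=
    exists_bump_norm_etaOp_sub_le μ ρ hρc v (half_pos hv')
  refine ⟨φ, hφc, hφs, hφ0, hφsymm, fun h0 => ?_⟩
  rw [h0, zero_sub, norm_neg] at hφv
  linarith

omit [MeasurableSpace G] in
/-- A real symmetric `φ` gives a `*`-fixed `f = ofReal ∘ φ`. -/
theorem starFun_ofReal_of_symm {φ : G → ℝ} (hφ : ∀ g, φ g⁻¹ = φ g) :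
    starFun (fun g => (φ g : ℂ)) = fun g => (φ g : ℂ) := by
  funext g
  simp only [starFun, Complex.conj_ofReal, hφ]

/-! ### [DE] Theorem 9.2.2 modulo compactness -/

/-- **[DE] Theorem 9.2.2 modulo compactness.** Let `ρ` be a strongly continuous unitary
representation of a locally compact group `G` on `E`, `μ` a Haar-type measure (open-positive,
finite on compacts, inversion invariant).  If every `η(f)`, `f ∈ C_c(G)` with `f* = f`, is a
COMPACT operator (for `L²(Γ\G)`, `Γ` cocompact: [DE] Lemmas 9.2.3–9.2.4, prose [C]), then `E` is
the closed orthogonal sum of irreducible closed stable subspaces — row 49's decomposition with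
symmetry and naturality from row 51 and the non-degeneracy from `exists_bump_etaOp_ne_zero`. -/
theorem exists_pairwise_isOrtho_irreducibleOn_of_isCompactOperator_etaOpL
    [TopologicalSpace G] [IsTopologicalGroup G] [LocallyCompactSpace G] [OpensMeasurableSpace G]
    [MeasurableInv G] (μ : Measure G) [μ.IsOpenPosMeasure] [IsFiniteMeasureOnCompacts μ]
    [μ.IsInvInvariant] (ρ : G →* (E →L[ℂ] E)) (hρ : ∀ g, star (ρ g) = ρ g⁻¹)
    (hρc : ∀ v : E, Continuous fun g => ρ g v)
    (hmeas : ∀ v : E, AEStronglyMeasurable (fun g => ρ g v) μ)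
    (hcpt : ∀ (f : G → ℂ) (hf : Integrable f μ), Continuous f → HasCompactSupport f →
      starFun f = f → IsCompactOperator (etaOpL μ ρ hρ hf hmeas)) :
    ∃ S : Set (Submodule ℂ E), (∀ U ∈ S, IrreducibleOn ρ U) ∧ S.Pairwise (fun U V => U ⟂ V) ∧
      (sSup S).topologicalClosure = ⊤ := by
  classical
  let 𝒯 : Set (E →L[ℂ] E) :=
    {T | ∃ (f : G → ℂ) (hf : Integrable f μ), Continuous f ∧ HasCompactSupport f ∧
      starFun f = f ∧ T = etaOpL μ ρ hρ hf hmeas}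
  refine exists_pairwise_isOrtho_irreducibleOn hρ 𝒯 ?_ ?_
  · rintro T ⟨f, hf, hfc, hfs, hstar, rfl⟩
    exact ⟨hcpt f hf hfc hfs hstar, isSymmetric_etaOpL μ ρ hρ hf hstar hmeas,
      fun U hUc hUs => etaOpL_mem_of_hasCompactSupport μ ρ hρ hρc hfc hfs hf hmeas hUc hUs⟩
  · intro v hv
    obtain ⟨φ, hφc, hφs, -, hφsymm, hφv⟩ := exists_bump_etaOp_ne_zero μ ρ hρc hv
    have hfc : Continuous fun g => (φ g : ℂ) := Complex.continuous_ofReal.comp hφc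
    have hfs : HasCompactSupport fun g => (φ g : ℂ) := hφs.comp_left Complex.ofReal_zero
    have hf : Integrable (fun g => (φ g : ℂ)) μ := hfc.integrable_of_hasCompactSupport hfs
    refine ⟨etaOpL μ ρ hρ hf hmeas, ⟨_, hf, hfc, hfs, starFun_ofReal_of_symm hφsymm, rfl⟩, ?_⟩
    rw [etaOpL_apply]
    exact hφv

end Summit.Ventures.HodgeRepro2.T5DiracApproximation
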